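import Summits.HodgeConjecture.HodgeConjecture.Theorems.SoloBlindTransportAnchors
import HarnessLib
import HarnessLib.Audit.Tags

/-!
# Local transport: the variational Hodge conjecture is a statement about germs

Solo-blind residency on `HodgeConjecture`, session s4 — the second rung of the PATH
`HC ⇔ (Hodge models) ∧ Transport ∧ AnchorSupply` (`SoloBlindTransportAnchors`, landed s3).

`Transport` (**T**) says that algebraicity is constant along connected components of the locus of
Hodge classes `locusOfHodgeClasses f n p ⊆ FiberClass f (2p)` of a smooth projective family. This
file splits (**T**) into two LOCAL statements about the subset
`{y | y.cls ∈ algebraicClasses (𝒳_{y.pt}) p}` of the locus of Hodge classes, for the étalé topology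
of `R²ᵖ f_* ℂ` (`FiberClass.instTopologicalSpace`):

* `LocalTransport` (**LT**) — it is RELATIVELY OPEN in the locus of Hodge classes: every algebraic
  fibre class `y` has a neighbourhood `U` in the étalé space such that every class of the locus of
  Hodge classes in `U` is algebraic. In words: *an algebraic class stays algebraic wherever, nearby,
  it stays a Hodge class* — Grothendieck's variational Hodge conjecture in germ form
  (Grothendieck 1966, footnote 13), i.e. exactly the CONCLUSION of the semiregularity theorems
  (Bloch 1972, Thm. 7.1/7.4: for a semiregular local complete intersection `Z ⊂ X` the Hodge locus
  of `[Z]` near `X` is the smooth locus where `Z` deforms; Buchweitz–Flenner 2003, Thm. 5.2/7.8 for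
  semiregular sheaves) with the semiregularity HYPOTHESIS removed. For hypersurfaces it is the
  question studied at the Fermat point by Movasati, Villaflor, Duque Franco, Dan and Kloosterman
  (is `NL(γ)_red` covered by loci where cycles representing `γ` deform? — e.g. Kloosterman,
  Math. Nachr. 2025 = arXiv:2401.10775, Thm. 1.1 and Rem. 4.1, for `[Π₁] + λ[Π₂]` with
  `dim Π₁ ∩ Π₂ = k - 1`: equality at a general point of `NL(Π₁, Π₂)`, an "expected embedded
  component" at split hypersurfaces such as Fermat).
* `AlgebraicLocusClosed` (**ALC**) — it is RELATIVELY CLOSED in the locus of Hodge classes.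
  Remark (not formalised): granted (**LT**), (**ALC**) follows from the structure theory of the
  locus — the algebraic sub-locus is a countable union of closed analytic subsets (relative Hilbert
  schemes are proper with countably many components: the tree's
  `charlesSchnell_algebraicityLocus_iUnion_closed`), each component of the locus of Hodge classes
  is a complex analytic space (Cattani–Deligne–Kaplan 1995), and a relatively open countable union
  of closed analytic subsets of an analytic space is a union of irreducible components (Baire +
  identity principle), hence closed. So (**LT**) is the whole content of (**T**); (**ALC**) is kept as
  an explicit hypothesis because the tree does not yet carry the analytic structure of the locus.

Results (sorry-free, general topology over the tree's real carriers):

* `transport_of_localTransport_of_algebraicLocusClosed : LocalTransport → AlgebraicLocusClosed →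
  Transport` — a relatively clopen subset of a preconnected set containing one of its points is all
  of it (`isPreconnected_iff_subset_of_disjoint` applied to `connectedComponentIn`);
* `localTransport_of_hodgeConjecture`, `algebraicLocusClosed_of_hodgeConjecture`;
* `hodgeConjecture_iff_localTransport :
    HodgeConjecture ↔ (∀ n X, nonempty_hodgeModel n X) ∧ LocalTransport ∧ AlgebraicLocusClosed ∧
      AnchorSupply`.

So the Hodge conjecture is equivalent to: Hodge models exist, the GERM statement (**LT**) at every
algebraic point of every locus of Hodge classes, its closed counterpart (**ALC**), and the anchor
supply (**A**). The only known engines for (**LT**) are unobstructedness theorems (semiregularity: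
Bloch, Buchweitz–Flenner, Pridham, Bandiera–Lepri–Manetti; pro-representability of twisted
deformations, Perry 2026) and first-order rigidity (`T_X NL(γ) = T_X N` for a smooth cycle locus
`N ∋ X`, which forces `NL(γ) = N` as germs); where they stop is recorded in the residency's
`PLAN.md` §3 and is not claimed here.

References: A. Grothendieck, *On the de Rham cohomology of algebraic varieties*, Publ. IHÉS 29
(1966), footnote 13; S. Bloch, *Semi-regularity and de Rham cohomology*, Invent. Math. 17 (1972),
§7; R.-O. Buchweitz, H. Flenner, *A semiregularity map for modules and applications to
deformations*, Compositio 137 (2003); E. Cattani, P. Deligne, A. Kaplan, *On the locus of Hodge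
classes*, JAMS 8 (1995); R. Kloosterman, *Hodge loci associated with linear subspaces intersecting
in codimension one*, Math. Nachr. (2025), arXiv:2401.10775; C. Voisin, *Hodge loci and absolute
Hodge classes*, Compositio 143 (2007), §1.
-/

noncomputable section

open CategoryTheory CategoryTheory.Limits AlgebraicGeometry Topology
open Literature.AlgebraicGeometry Literature.AlgebraicGeometry.Motives
open Literature.AlgebraicGeometry.HodgeTheory
open Literature.AlgebraicTopology.SingularHomology

namespace Summit.HodgeConjecture.HodgeConjecture.Theorems.SoloBlind

/-! ### The two local statements -/

/-- **(LT) Local transport** (variational Hodge conjecture, germ form): in a smooth projective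
family, every ALGEBRAIC fibre class `y` has an open neighbourhood `U` in the étalé space
`FiberClass f (2p)` of `R²ᵖ f_* ℂ` such that every class of the locus of Hodge classes lying in `U`
is algebraic — the algebraic sub-locus is relatively open in the locus of Hodge classes.
[cite: Grothendieck1966, footnote 13] [cite: Bloch1972Semiregularity, Thm. 7.1] -/
@[conjecture] def LocalTransport : Prop :=
  ∀ ⦃n : ℕ⦄ ⦃𝒳 S : SchemeOver ℂ⦄ ⦃f : 𝒳 ⟶ S⦄, IsSmoothProjectiveFamily f n →
    ∀ (p : ℕ) (y : FiberClass f (2 * p)), y ∈ locusOfHodgeClasses f n p →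
      y.cls ∈ algebraicClasses (fiberOver f y.pt) p →
      ∃ U : Set (FiberClass f (2 * p)), IsOpen U ∧ y ∈ U ∧
        ∀ z ∈ U, z ∈ locusOfHodgeClasses f n p → z.cls ∈ algebraicClasses (fiberOver f z.pt) p

/-- **(ALC) The algebraic sub-locus is relatively closed in the locus of Hodge classes**: every
NON-algebraic class of the locus of Hodge classes has an open neighbourhood in the étalé space on
which no class of the locus is algebraic. (Granted (LT), a consequence of Cattani–Deligne–Kaplan and
the countability of relative Hilbert schemes — see the module docstring; trivially a consequence of
the Hodge conjecture.) [cite: CattaniDeligneKaplan1995, Cor. 1.2] [cite: Voisin2007HodgeLoci, §1] -/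
@[conjecture] def AlgebraicLocusClosed : Prop :=
  ∀ ⦃n : ℕ⦄ ⦃𝒳 S : SchemeOver ℂ⦄ ⦃f : 𝒳 ⟶ S⦄, IsSmoothProjectiveFamily f n →
    ∀ (p : ℕ) (y : FiberClass f (2 * p)), y ∈ locusOfHodgeClasses f n p →
      y.cls ∉ algebraicClasses (fiberOver f y.pt) p →
      ∃ U : Set (FiberClass f (2 * p)), IsOpen U ∧ y ∈ U ∧
        ∀ z ∈ U, z ∈ locusOfHodgeClasses f n p → z.cls ∉ algebraicClasses (fiberOver f z.pt) p

/-! ### (LT) ∧ (ALC) ⇒ (T): a relatively clopen part of a connected component is everything -/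

/-- **(LT) ∧ (ALC) ⇒ (T).** In the connected component `Z` of the locus of Hodge classes through an
algebraic class `x`, the algebraic classes form a relatively open (LT) and relatively closed (ALC)
subset containing `x`; `Z` being preconnected (`isPreconnected_connectedComponentIn`), it is all of
`Z` (`isPreconnected_iff_subset_of_disjoint`). [cite: Grothendieck1966, footnote 13] -/
theorem transport_of_localTransport_of_algebraicLocusClosed (hLT : LocalTransport)
    (hALC : AlgebraicLocusClosed) : Transport := by
  intro n 𝒳 S f hf p x y hy hxalg
  -- the locus of Hodge classes and the component through `x`
  set L : Set (FiberClass f (2 * p)) := locusOfHodgeClasses f n p with hL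
  have hZL : connectedComponentIn L x ⊆ L := connectedComponentIn_subset _ _
  have hyL : y ∈ L := hZL hy
  have hxZ : x ∈ connectedComponentIn L x := by
    -- `y ∈ connectedComponentIn L x` forces `x ∈ L` (otherwise the component is empty)
    by_cases hxL : x ∈ L
    · exact mem_connectedComponentIn hxL
    · exact absurd hy (by rw [connectedComponentIn_eq_empty hxL]; exact Set.notMem_empty y)
  -- the open sets witnessing relative openness / closedness
  let u : Set (FiberClass f (2 * p)) :=
    ⋃₀ {U | IsOpen U ∧ ∀ z ∈ U, z ∈ L → z.cls ∈ algebraicClasses (fiberOver f z.pt) p}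
  let v : Set (FiberClass f (2 * p)) :=
    ⋃₀ {U | IsOpen U ∧ ∀ z ∈ U, z ∈ L → z.cls ∉ algebraicClasses (fiberOver f z.pt) p}
  have hu : IsOpen u := isOpen_sUnion fun U hU => hU.1
  have hv : IsOpen v := isOpen_sUnion fun U hU => hU.1
  -- the component is covered by `u ∪ v`
  have hcover : connectedComponentIn L x ⊆ u ∪ v := by
    intro z hz
    have hzL : z ∈ L := hZL hz
    by_cases hzalg : z.cls ∈ algebraicClasses (fiberOver f z.pt) p
    · obtain ⟨U, hUo, hzU, hU⟩ := hLT hf p z hzL hzalg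
      exact Or.inl (Set.mem_sUnion.2 ⟨U, ⟨hUo, hU⟩, hzU⟩)
    · obtain ⟨U, hUo, hzU, hU⟩ := hALC hf p z hzL hzalg
      exact Or.inr (Set.mem_sUnion.2 ⟨U, ⟨hUo, hU⟩, hzU⟩)
  -- `u` and `v` are disjoint on the component
  have hdisj : connectedComponentIn L x ∩ (u ∩ v) = ∅ := by
    apply Set.eq_empty_of_forall_notMem
    rintro z ⟨hz, hzu, hzv⟩
    have hzL : z ∈ L := hZL hz
    obtain ⟨U, ⟨-, hU⟩, hzU⟩ := Set.mem_sUnion.1 hzu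
    obtain ⟨U', ⟨-, hU'⟩, hzU'⟩ := Set.mem_sUnion.1 hzv
    exact hU' z hzU' hzL (hU z hzU hzL)
  -- preconnectedness: the component lies in `u` or in `v`
  have hZ := (isPreconnected_iff_subset_of_disjoint.1
    (isPreconnected_connectedComponentIn (F := L) (x := x))) u v hu hv hcover hdisj
  -- it is not in `v`, because `x` is algebraic
  have hxL : x ∈ L := hZL hxZ
  rcases hZ with hZu | hZv
  · obtain ⟨U, ⟨-, hU⟩, hyU⟩ := Set.mem_sUnion.1 (hZu hy)
    exact hU y hyU hyL
  · obtain ⟨U, ⟨-, hU⟩, hxU⟩ := Set.mem_sUnion.1 (hZv hxZ)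
    exact absurd hxalg (hU x hxU hxL)

/-! ### The Hodge conjecture implies (LT) and (ALC) -/

/-- **HC ⇒ (LT)**: under the Hodge conjecture every class of the locus of Hodge classes is
algebraic, so `U = univ` works. [cite: Deligne2000, §1] -/
theorem localTransport_of_hodgeConjecture (h : _root_.HodgeConjecture) : LocalTransport := by
  intro n 𝒳 S f hf p y _ _
  refine ⟨Set.univ, isOpen_univ, Set.mem_univ y, fun z _ hzL => ?_⟩
  exact (h (hf.isSmoothProjective z.pt)).2 p z.cls hzL.1 hzL.2

/-- **HC ⇒ (ALC)**: under the Hodge conjecture there is no non-algebraic class in the locus of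
Hodge classes. [cite: Deligne2000, §1] -/
theorem algebraicLocusClosed_of_hodgeConjecture (h : _root_.HodgeConjecture) :
    AlgebraicLocusClosed := by
  intro n 𝒳 S f hf p y hyL hyalg
  exact absurd ((h (hf.isSmoothProjective y.pt)).2 p y.cls hyL.1 hyL.2) hyalg

/-! ### The local form of the path -/

/-- **(models) ∧ (LT) ∧ (ALC) ∧ (A) ⇒ HC.** [cite: Grothendieck1966, footnote 13]
[cite: Voisin2007HodgeLoci, §0] -/
theorem hodgeConjecture_of_localTransport
    (hM : ∀ (n : ℕ) (X : SchemeOver ℂ), nonempty_hodgeModel n X) (hLT : LocalTransport)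
    (hALC : AlgebraicLocusClosed) (hA : AnchorSupply) : _root_.HodgeConjecture :=
  hodgeConjecture_of_transport_of_anchorSupply hM
    (transport_of_localTransport_of_algebraicLocusClosed hLT hALC) hA

/-- **The path, local form.** The Hodge conjecture is equivalent to: Hodge models exist, algebraic
classes stay algebraic wherever nearby they stay Hodge (LT), the algebraic sub-locus of the locus of
Hodge classes is relatively closed (ALC), and every Hodge class has an anchor (A).
[cite: Grothendieck1966, footnote 13] [cite: Deligne2000, §1] -/
theorem hodgeConjecture_iff_localTransport :
    _root_.HodgeConjecture ↔
      (∀ (n : ℕ) (X : SchemeOver ℂ), nonempty_hodgeModel n X) ∧ LocalTransport ∧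
        AlgebraicLocusClosed ∧ AnchorSupply :=
  ⟨fun h => ⟨nonempty_hodgeModel_of_hodgeConjecture h, localTransport_of_hodgeConjecture h,
      algebraicLocusClosed_of_hodgeConjecture h, anchorSupply_of_hodgeConjecture h⟩,
    fun h => hodgeConjecture_of_localTransport h.1 h.2.1 h.2.2.1 h.2.2.2⟩

end Summit.HodgeConjecture.HodgeConjecture.Theorems.SoloBlind

end
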